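import Literature.MathematicalPhysics.QuantumFieldTheory.Balaban1983to89.B4Prop31Regular
import Literature.MathematicalPhysics.QuantumFieldTheory.Balaban1983to89.B2Lemma24KerOmegaTorusShift
import Literature.MathematicalPhysics.QuantumFieldTheory.Balaban1983to89.B4Ineq46Lattice

/-!
# `Balaban1983to89.B4Prop31TorusTransfer` — [Balaban1983RegularityDecay] «Proposition 3.1′ of [2]» (1.21)–(1.22)
# p. 574 ON A REGION OF THE TORUS `T_η`: THE TRANSFER LEMMAS — the quadratic form of `Δ^{(k)}(Ω,A)` (1.14) is
# MONOTONE in the bond weights of (1.3) (variational representation (4.1)–(4.3)), hence the torus form dominates the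
# Neumann form of every fundamental domain; the torus form is invariant under the translations of `T_η`; the
# unit-lattice links `U(A(⟨y, y + e_μ⟩))` of (1.22) read through the periodic field and through a translation; every
# unit bond of the torus is a lattice bond of the period box or of the period box translated by `(1,…,1)`

statement-level skeleton of published theorems with citation tags; proofs where landed; nothing here is a claim about
the Yang–Mills mass gap

CITATION HEADER.  T. Bałaban, *Regularity and decay of lattice Green's functions*, Commun. Math. Phys. **89** (1983)
571–597, doi:10.1007/bf01214744 [Balaban1983RegularityDecay] (cell paper B4; held text
`paper:balaban1983-cmp89-regularity-decay`, journal page = PDF page + 570; p. 572 [PDF 2] (1.1)–(1.6) and «operators on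
subsets of a torus T_η», p. 573 (1.14), p. 574 (1.21)–(1.22), p. 589 (4.1)–(4.3) re-read by this seat on the text
layer).  Cell `pub-ymgap`, Track-A seat `pub-ymgap-dag-n01-b` gen 0 (node N01 of YM-PLAN §2; located reading of
row N01's famF: cross-read XREAD-B4 v0.5 §7 scope (f1) «`B4Prop31Regular.regularFormSetting` is typed on regions of
`ηℤ^{d+1}`, not on torus regions — ADMIT candidate, same species as F-torusU»; `B4Prop31Zero` module docstring: «The
torus variant is not typed here»).  File 1 of 2 (THEOREMS ONLY: no `def`, no `Prop`-valued fact, no `sorry`, axioms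
standard); file 2 `B4Prop31TorusFamily` assembles (1.22) on torus regions and the typed leaf `B4.Prop31Printed` on a
torus family.  USED BY NAME, never restated: p35's variational dictionary `B4Prop31Energy.{keff, cenergy, gStar,
cenergy_gStar, cenergy_ge_keff}` ((1.14), (4.1)–(4.3)), p35's region carriers `B4Prop31Charts.{linkR, transR,
b4Op_region_eq}` and straight-contour links `B4Prop31Holonomy.{clink, clink_eq, segSum_eq_sum, base}`, b04's
`B4GaugeCovariance` block calculus (`covLap`, `covOp`, `avgOp`, `fieldLink`, `contourTrans`), pv17/b04 region data
`B4Lower18RegularRegion.{regWt, rBlkWt, rbaseEmb, rstairContour, compField, covLap_congr, covLap_form_mono}`, r01 g9's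
torus objects `B4TorusRegionOp.{per, twrap, torWt, torBond, torusOp, perField, regWt_le_torWt, fieldLink_tor_eq_of_nbrs,
contourTrans_tor_eq, torusOp_isUnit_det, val_mem_perBox}`, p23 g20's TORUS TRANSLATION LEMMA
`B2Lemma24KerOmegaTorusShift.{tlab, shiftLabels, tfin, σT, σY, σTι, σYι, torusOp_shift, green_shift, avgQ_shift,
tfin_eq_add_of_blk}`, p23's `B2Prop22RegularRegionPair.avgQ`, p35 g4's `B4Eq16GreenExists.b4Op_region_posDef` and r04's
`B4Ineq46Lattice.exists_pos_mul_le_form_of_posDef`.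

WHAT IS PRINTED (verbatim).  p. 572: «Another common case is to consider operators on subsets of a torus T_η which we
identify with a rectangular parallelepiped in ηZ^d with periodic conditions.»; (1.3) «⟨φ,(−Δ^{η,N}_{A,Ω})φ⟩ =
Σ_{b⊂Ω} η^d|η^{−1}(U(A_b)φ(b_+) − φ(b_−))|², where the summation is over the set of all bonds b = ⟨b_−,b_+⟩ with
end-points b_−, b_+ in Ω»; p. 573: «Δ^{(k)}(Ω,A) = a_kI − a_k²Q_k(A)G_k(Ω,A)Q_k^*(A), (1.14)»; p. 574: «Proposition 3.1′
of [2]: Let Ω be a sum of unit blocks (i.e. Ω^{(k)} is an arbitrary subset of Z^d) and let A satisfies the condition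
|(∂^η_μA)(x)| ≤ O(1)p(e) (p(e) = a₀(1 + log e^{−1})^p), (1.21) then there exists a positive constant γ₀ depending on d
only, such that for e sufficiently small ⟨φ, Δ^{(k)}(Ω,A)φ⟩ ≥ γ₀(Σ_{⟨x,x′⟩⊂Ω^{(k)}}|U(A(⟨x,x′⟩))φ(x′) − φ(x)|² +
m²Σ_{x∈Ω^{(k)}}|φ(x)|²) − O(1)e^{2−α}Σ_{x∈Ω^{(k)}}|φ(x)|² (1.22)»; p. 589: «At first we have G_k(Ω,A) ≤ ((a_kP_k(A) +
m²)|_Ω)^{−1} … Each term of the above sum is determined by the integral ∫dφ′|_{B^k(x)} exp[−½a_k|φ(x) −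
(Q_k(A)φ′)(x)|² − ½m²Σ_{x′∈B^k(x)}η^d|φ′(x′)|²]. (4.2)».

DICTIONARY (lattice units, `d + 1` dimensions, as r01 g9 / p23 g20 / p35).  Fine mesh `n = η⁻¹ ≥ 1`; the torus
`T_η = Π_ν ℤ/(nP_ν)` has `P_ν` unit blocks per direction and is read on its period boxes of representatives (unit labels
`Π_ν[0,P_ν)` = `boxDom P`, fine points `boxDom (per n P)`); a torus region `Ω` = the unit blocks with labels in
`Ω_T ⊆ boxDom P` («Ω a sum of unit blocks»), carrier `fineDom n Ω_T`; the torus field `A_ν(x)` in component form on the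
fine period box (`Ac`), its periodic extension `perField n P Ac`; coupling `κ = eη = e/n`; `Δ^{(k)}_T(Ω,A)` = p35's
`keff` at r01's torus data (bond weights `torWt` — the wrap-around bonds INCLUDED —, block weights `rBlkWt`, links
`U(κ·torBond)`, staircase transporters), whose `covOp` IS r01's `torusOp` (`keff_torus_eq`, definitional); the Neumann
operator of the fundamental domain = p35's `regularFormSetting` data at `(n, Ω_T, e, perField n P Ac)`; the
translation of `T_η` by `t ∈ ℤ^{d+1}` unit blocks = p23's `tlab`/`shiftLabels`/`tfin`/`σT`/`σY`.

WHAT THIS MODULE PROVES (all in full).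
* §1 `cenergy_mono`, **`keff_form_mono`** — MONOTONICITY OF `⟨ψ, Δ^{(k)}ψ⟩` IN THE BOND WEIGHTS (generic finite
  carriers): if `c ≤ c′` pointwise, the links agree on the `c`-bonds, the block data coincide, `s ≥ 0`, `H_c ≥ γ > 0`
  and `H_{c′}` is invertible, then `⟨ψ, Δ^{(k)}_cψ⟩ ≤ ⟨ψ, Δ^{(k)}_{c′}ψ⟩` — because `⟨ψ, Δ^{(k)}ψ⟩ = min_Φ F(Φ,ψ)`
  ((4.1)–(4.3), p35's `cenergy_gStar`/`cenergy_ge_keff`) and the exponent `F` of (4.2) is monotone in the weights of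
  (1.3).  (The print's first step «G_k(Ω,A) ≤ ((a_kP_k(A) + m²)|_Ω)^{−1}» is the case `c = 0`.)
* §2 `keff_torus_eq` (dictionary, `rfl`), `transR_perField_eq`, **`keff_region_le_torus`** — THE TORUS FORM OF
  `Δ^{(k)}` DOMINATES THE NEUMANN FORM OF THE FUNDAMENTAL DOMAIN: `⟨ψ, Δ^{(k)}_ℤ(Ω_T, A^per)ψ⟩ ≤ ⟨ψ, Δ^{(k)}_T(Ω, A)ψ⟩`
  for every torus region, every field, `a > 0`, `m² ≥ 0` (fine period `≥ 3`): r01's `regWt ≤ torWt`, links and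
  transporters agree (`fieldLink_tor_eq_of_nbrs`, `contourTrans_tor_eq`), §1.
* §3 **`keff_torus_shift`**, **`tform_shift`**, `l2_shift` — `Δ^{(k)}_T` IS COVARIANT UNDER THE TRANSLATIONS OF `T_η`:
  `Δ^{(k)}_T(Ω + t, A(· − nt))|_{σY×σY} = Δ^{(k)}_T(Ω, A)` (p23's `torusOp_shift`, `green_shift`, `avgQ_shift`), hence
  `⟨ψ∘σY⁻¹, Δ^{(k)}_T(Ω + t, A′)(ψ∘σY⁻¹)⟩ = ⟨ψ, Δ^{(k)}_T(Ω,A)ψ⟩` and `|ψ∘σY⁻¹|² = |ψ|²`.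
* §4 `base_add_mem_perBox`, `blk_base_add`, **`clink_perField`**, **`clink_shift`** — the unit-lattice link
  `U(A(⟨y, y+e_μ⟩))` of (1.22) (p35's `clink`: the straight fine contour of `n` steps inside `B(y)`) is the same for the
  torus field and its periodic extension, and relabels under the translation: `clink (A′)^per (y + t mod P) = clink A y`.
* §5 `tlab_wrap_add_e1`, `tlab_wrap_add_e1_of_mem`, **`bond_cover`** — THE TWO-CHART COVER OF THE TORUS BONDS: for
  `P_μ ≥ 2`, the unit bond `⟨y, y + e_μ mod P⟩` is a lattice bond of the period box (`y + e_μ ∈ boxDom P`) or of the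
  period box of the torus translated by `𝟙 = (1,…,1)` (`(y + 𝟙 mod P) + e_μ ∈ boxDom P`), and in the latter chart its
  end-point is the translate of `y + e_μ mod P`.
HONEST SCOPE.  Bookkeeping + one variational inequality; no constant of [B4] is touched.  The route (Neumann
fundamental domains of the torus in two positions, variational monotonicity) is THIS LINEAGE'S device for reading p35's
lattice theorem on the torus — the print proves (1.22) directly by the local argument of §4, which does not see the
difference between `ηℤ^{d+1}` and `T_η`; fine period `nP_ν ≥ 3` (r01's simple-graph convention) and `P_ν ≥ 2` are
unprinted non-degeneracy conventions of the torus family (the print's tori are large).  Count-neutral for YM-PLAN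
(typed 28∕28 · discharged 0∕28 unmoved); nothing here concerns the continuum, ℝ⁴, OS axioms, a mass gap or the Clay
problem.
-/

namespace Literature.MathematicalPhysics.QuantumFieldTheory.Balaban1983to89.B4Prop31TorusTransfer

open Matrix Finset
open Literature.MathematicalPhysics.QuantumFieldTheory.Balaban1983to89
open Literature.MathematicalPhysics.QuantumFieldTheory.Balaban1983to89.B4GaugeCovariance
open Literature.MathematicalPhysics.QuantumFieldTheory.Balaban1983to89.B4Lower18 (fineDom mem_fineDom)
open Literature.MathematicalPhysics.QuantumFieldTheory.Balaban1983to89.B4Lower18Regular (e1 e1_apply_self e1_apply_ne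
  add_nsmul_e1_apply dotProduct_self_nonneg')
open Literature.MathematicalPhysics.QuantumFieldTheory.Balaban1983to89.B4Lower18RegularRegion (regWt rBlkWt rbaseEmb
  rstairContour compField regWt_nonneg covLap_congr covLap_form_mono)
open Literature.MathematicalPhysics.QuantumFieldTheory.Balaban1983to89.B4Reflection242 (nbrs blk boxDom mem_boxDom)
open Literature.MathematicalPhysics.QuantumFieldTheory.Balaban1983to89.B4TorusPositivity (wrap wrap_wrap_add)
open Literature.MathematicalPhysics.QuantumFieldTheory.Balaban1983to89.B4TorusRegionOp
open Literature.MathematicalPhysics.QuantumFieldTheory.Balaban1983to89.B4Prop31Energy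
open Literature.MathematicalPhysics.QuantumFieldTheory.Balaban1983to89.B4Prop31Holonomy (clink clink_eq segSum
  segSum_eq_sum base)
open Literature.MathematicalPhysics.QuantumFieldTheory.Balaban1983to89.B4Prop31Charts (linkR transR b4Op_region_eq)
open Literature.MathematicalPhysics.QuantumFieldTheory.Balaban1983to89.B2Lemma24KerOmegaTorusShift (tlab shiftLabels
  tfin σT σY σTι σYι σTι_eq σYι_eq torusOp_shift green_shift avgQ_shift tfin_eq_add_of_blk tlab_mem_boxDom wrap_of_mem
  tlab_neg_tlab)
open Literature.MathematicalPhysics.QuantumFieldTheory.Balaban1983to89.B2Prop22RegularRegionPair (avgQ)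
open Literature.MathematicalPhysics.QuantumFieldTheory.Balaban1983to89.B4Ineq46Lattice
  (exists_pos_mul_le_form_of_posDef)
open Literature.MathematicalPhysics.QuantumFieldTheory.Balaban1983to89.B4Eq16GreenExists (b4Op_region_posDef)

noncomputable section

/-! ## §1. The form of `Δ^{(k)}` is monotone in the bond weights (variational representation (4.1)–(4.3)) -/

section Generic

variable {X Y ι : Type} [Fintype X] [Fintype Y] [Fintype ι] [DecidableEq X] [DecidableEq Y] [DecidableEq ι]

omit [DecidableEq Y] in
/-- the exponent `F(Φ′, ψ)` of the Gaussian integral (4.2) is MONOTONE in the bond weights of (1.3): fewer (or lighter)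
bonds, smaller fine energy; the block term and the mass term do not see the weights.
[cite: Balaban1983RegularityDecay, p. 589 (4.2) with p. 572 (1.3)] -/
theorem cenergy_mono {c c' : X → X → ℝ} (hle : ∀ x y, c x y ≤ c' x y) {W W' : X → X → Matrix ι ι ℝ}
    (hW : ∀ x y, c x y ≠ 0 → W x y = W' x y) (m2 a : ℝ) {s : ℝ} (hs : 0 ≤ s) (q : Y → X → ℝ)
    (T : Y → X → Matrix ι ι ℝ) (Φ : X × ι → ℝ) (ψ : Y × ι → ℝ) :
    cenergy c m2 a s q W T Φ ψ ≤ cenergy c' m2 a s q W' T Φ ψ := by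
  unfold cenergy
  have h1 : Φ ⬝ᵥ (covLap c W *ᵥ Φ) ≤ Φ ⬝ᵥ (covLap c' W' *ᵥ Φ) := by
    rw [covLap_congr hW]
    exact covLap_form_mono hle W' Φ
  have h2 : Φ ⬝ᵥ ((covLap c W + m2 • (1 : Matrix (X × ι) (X × ι) ℝ)) *ᵥ Φ)
      ≤ Φ ⬝ᵥ ((covLap c' W' + m2 • (1 : Matrix (X × ι) (X × ι) ℝ)) *ᵥ Φ) := by
    rw [Matrix.add_mulVec, Matrix.add_mulVec, dotProduct_add, dotProduct_add]
    linarith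
  have h3 := mul_le_mul_of_nonneg_left h2 hs
  linarith

/-- **`⟨ψ, Δ^{(k)}ψ⟩` IS MONOTONE IN THE BOND WEIGHTS OF (1.3)** (generic finite carriers): for weights `c ≤ c′`
(pointwise), link variables agreeing on the `c`-bonds, the same block weights / transporters / `m²` / `a` / `s ≥ 0`,
`H_c = −Δ_{c,W} + m² + (as)Q^*Q ≥ γ > 0` and `H_{c′}` invertible:
`⟨ψ, (a − a²s·QG_cQᵀ)ψ⟩ ≤ ⟨ψ, (a − a²s·QG_{c′}Qᵀ)ψ⟩` — by the variational representation (4.1)–(4.3):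
`⟨ψ, Δ^{(k)}_{c′}ψ⟩ = F_{c′}(Φ⋆′, ψ) ≥ F_c(Φ⋆′, ψ) ≥ ⟨ψ, Δ^{(k)}_cψ⟩`.  (The print's «G_k(Ω,A) ≤ ((a_kP_k(A) +
m²)|_Ω)^{−1}» (4.1) is the instance `c = 0`.) [cite: Balaban1983RegularityDecay, p. 589 (4.1)–(4.3), p. 573 (1.14)] -/
theorem keff_form_mono {c c' : X → X → ℝ} (hle : ∀ x y, c x y ≤ c' x y) {W W' : X → X → Matrix ι ι ℝ}
    (hW : ∀ x y, c x y ≠ 0 → W x y = W' x y) (m2 a : ℝ) {s : ℝ} (hs : 0 ≤ s) (q : Y → X → ℝ)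
    (T : Y → X → Matrix ι ι ℝ) {γ : ℝ} (hγ : 0 < γ)
    (hH : ∀ v, γ * (v ⬝ᵥ v) ≤ v ⬝ᵥ (covOp c m2 (a * s) q W T *ᵥ v))
    (hH' : IsUnit (covOp c' m2 (a * s) q W' T).det) (ψ : Y × ι → ℝ) :
    ψ ⬝ᵥ (keff c m2 a s q W T *ᵥ ψ) ≤ ψ ⬝ᵥ (keff c' m2 a s q W' T *ᵥ ψ) := by
  rw [← cenergy_gStar hH' ψ]
  exact (cenergy_ge_keff hγ hs hH _ ψ).trans (cenergy_mono hle hW m2 a hs q T _ ψ)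

end Generic

variable {d : ℕ} {ι : Type} [Fintype ι] [DecidableEq ι]

/-! ## §2. The torus form of `Δ^{(k)}(Ω, A)` dominates the Neumann form of the fundamental domain -/

section Chart

variable (F : OrthFlow ι) {n : ℕ} (hn : 1 ≤ n) {P : Fin (d + 1) → ℕ} (h3 : ∀ ν, 3 ≤ per n P ν)
  {ΩT : Finset (Fin (d + 1) → ℤ)} (hΩ : ΩT ⊆ boxDom P)

/-- **DICTIONARY**: `Δ^{(k)}_T(Ω, A)` (1.14) on the torus region in p35's variational dictionary (`keff` at r01's torus
bond weights, block weights, torus links and staircase transporters, `κ = e/n`, `s = n^{−(d+1)}`) IS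
`a·1 − a²s·Q_k(A)·G_k(Ω,A)·Q_k(A)ᵀ` with r01's torus Green's function `(torusOp …)⁻¹` (1.6) and p23's averaging operator
`avgQ` (1.4) — definitionally. [cite: Balaban1983RegularityDecay, p. 573 (1.14), p. 572 (1.4)–(1.6) «operators on subsets of a torus T_η»] -/
theorem keff_torus_eq (e : ℝ) (a m2 : ℝ) (P : Fin (d + 1) → ℕ) (ΩT : Finset (Fin (d + 1) → ℤ))
    (Ac : (Fin (d + 1) → ℤ) → Fin (d + 1) → ℝ) :
    keff (torWt n P (fineDom n ΩT)) m2 a (((n : ℝ) ^ (d + 1))⁻¹) (rBlkWt n ΩT (fineDom n ΩT))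
        (fieldLink F (e / n) fun u v : ↥(fineDom n ΩT) => torBond n P Ac u.1 v.1)
        (contourTrans (fieldLink F (e / n) fun u v : ↥(fineDom n ΩT) => torBond n P Ac u.1 v.1) (rbaseEmb hn ΩT)
          (rstairContour hn ΩT))
      = a • (1 : Matrix _ _ ℝ) - (a ^ 2 * ((n : ℝ) ^ (d + 1))⁻¹) •
          (avgQ F (e / n) hn ΩT (fun u v : ↥(fineDom n ΩT) => torBond n P Ac u.1 v.1)
            * (torusOp F e hn a m2 P ΩT Ac)⁻¹
            * (avgQ F (e / n) hn ΩT (fun u v : ↥(fineDom n ΩT) => torBond n P Ac u.1 v.1))ᵀ) := rfl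

include h3 hΩ in
/-- p35's transporters `U(A^per(Γ_{y,x}))` of the fundamental domain ARE r01's torus transporters (the staircase
contours run through lattice bonds inside unit blocks, where the torus field is the periodic field).
[cite: Balaban1983RegularityDecay, (1.4) p. 572 «U(A(Γ^{(k)}_{y,x}))»] -/
theorem transR_perField_eq (κ : ℝ) (Ac : (Fin (d + 1) → ℤ) → Fin (d + 1) → ℝ) :
    transR F κ hn ΩT (perField n P Ac)
      = contourTrans (fieldLink F κ fun u v : ↥(fineDom n ΩT) => torBond n P Ac u.1 v.1) (rbaseEmb hn ΩT)
          (rstairContour hn ΩT) :=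
  (contourTrans_tor_eq F hn h3 hΩ κ Ac).symm

include h3 hΩ in
/-- **THE TORUS FORM OF `Δ^{(k)}(Ω, A)` DOMINATES THE NEUMANN FORM OF THE FUNDAMENTAL DOMAIN**: for every torus region
`Ω` (labels `Ω_T ⊆ boxDom P`, fine period `≥ 3`), every torus field `A`, charge `e`, `a > 0`, `m² ≥ 0` and every
`ψ : Ω^{(k)} → ℝ^N`,
`⟨ψ, Δ^{(k)}_ℤ(Ω_T, A^per)ψ⟩ ≤ ⟨ψ, Δ^{(k)}_T(Ω, A)ψ⟩`,
the left side being p35's lattice form (`regularFormSetting` data at `(n, Ω_T, e, A^per)`: Neumann bonds of the period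
box only).  The wrap-around bonds are extra non-negative terms of (1.3) (r01's `regWt_le_torWt`), the links agree on the
lattice bonds and the block transporters coincide; §1. [cite: Balaban1983RegularityDecay, p. 573 (1.14), p. 572 (1.3)–(1.6), p. 589 (4.1)–(4.3)] -/
theorem keff_region_le_torus (e : ℝ) {a : ℝ} (ha : 0 < a) {m2 : ℝ} (hm : 0 ≤ m2)
    (Ac : (Fin (d + 1) → ℤ) → Fin (d + 1) → ℝ) (ψ : ↥ΩT × ι → ℝ) :
    ψ ⬝ᵥ (keff (regWt n (fineDom n ΩT)) m2 a (((n : ℝ) ^ (d + 1))⁻¹) (rBlkWt n ΩT (fineDom n ΩT))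
        (linkR F (e / n) n ΩT (perField n P Ac)) (transR F (e / n) hn ΩT (perField n P Ac)) *ᵥ ψ)
      ≤ ψ ⬝ᵥ (keff (torWt n P (fineDom n ΩT)) m2 a (((n : ℝ) ^ (d + 1))⁻¹) (rBlkWt n ΩT (fineDom n ΩT))
        (fieldLink F (e / n) fun u v : ↥(fineDom n ΩT) => torBond n P Ac u.1 v.1)
        (contourTrans (fieldLink F (e / n) fun u v : ↥(fineDom n ΩT) => torBond n P Ac u.1 v.1) (rbaseEmb hn ΩT)
          (rstairContour hn ΩT)) *ᵥ ψ) := by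
  have hn0 : (0 : ℝ) < n := by exact_mod_cast hn
  have hT := transR_perField_eq F hn h3 hΩ (e / n) Ac
  -- the Neumann operator of the fundamental domain is positive definite (p35 g4), hence `≥ γ > 0`
  have hpd := b4Op_region_posDef F (e / n) hn ha hm ΩT
    (fun u v : ↥(fineDom n ΩT) => compField (perField n P Ac) u.1 v.1)
  obtain ⟨γ, hγ, hH⟩ := exists_pos_mul_le_form_of_posDef hpd
  have hH1 : ∀ v, γ * (v ⬝ᵥ v) ≤ v ⬝ᵥ (covOp (regWt n (fineDom n ΩT)) m2 (a * ((n : ℝ) ^ (d + 1))⁻¹)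
      (rBlkWt n ΩT (fineDom n ΩT)) (linkR F (e / n) n ΩT (perField n P Ac))
      (contourTrans (fieldLink F (e / n) fun u v : ↥(fineDom n ΩT) => torBond n P Ac u.1 v.1) (rbaseEmb hn ΩT)
        (rstairContour hn ΩT)) *ᵥ v) := by
    intro v
    have h := hH v
    rw [b4Op_region_eq, hT] at h
    exact h
  rw [hT]
  refine keff_form_mono (regWt_le_torWt hn hΩ) ?_ m2 a (by positivity) _ _ hγ hH1 ?_ ψ
  · intro u v huv
    have hnb : v.1 ∈ nbrs u.1 := by
      by_contra hc
      exact huv (by simp [regWt, hc])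
    exact (fieldLink_tor_eq_of_nbrs F hn h3 hΩ (e / n) Ac hnb).symm
  · exact torusOp_isUnit_det F hn hΩ e ha hm Ac

end Chart

/-! ## §3. `Δ^{(k)}_T(Ω, A)` is covariant under the translations of `T_η` -/

section Shift

variable (F : OrthFlow ι) {n : ℕ} (hn : 1 ≤ n) (P : Fin (d + 1) → ℕ) (hP : ∀ ν, 1 ≤ P ν) (t : Fin (d + 1) → ℤ)
  {Ω : Finset (Fin (d + 1) → ℤ)} (hΩ : Ω ⊆ boxDom P)
  (Ac Ac' : (Fin (d + 1) → ℤ) → Fin (d + 1) → ℝ) (hA : ∀ z ∈ boxDom (per n P), Ac' (tfin P t n z) = Ac z)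

include hP hΩ hA in
/-- **THE TORUS TRANSLATION LEMMA FOR `Δ^{(k)}` (1.14)**: `Δ^{(k)}_T(Ω + t, A′)|_{σY × σY} = Δ^{(k)}_T(Ω, A)` for the
relabelled field `A′(x + nt) = A(x)` — from p23 g20's translation lemmas for `G_k(Ω,A)` and `Q_k(A)`.
[cite: Balaban1983RegularityDecay, p. 573 (1.14), p. 572 «a rectangular parallelepiped … with periodic conditions»] -/
theorem keff_torus_shift (e a m2 : ℝ) :
    (keff (torWt n P (fineDom n (shiftLabels P t Ω))) m2 a (((n : ℝ) ^ (d + 1))⁻¹)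
        (rBlkWt n (shiftLabels P t Ω) (fineDom n (shiftLabels P t Ω)))
        (fieldLink F (e / n) fun u v : ↥(fineDom n (shiftLabels P t Ω)) => torBond n P Ac' u.1 v.1)
        (contourTrans (fieldLink F (e / n) fun u v : ↥(fineDom n (shiftLabels P t Ω)) => torBond n P Ac' u.1 v.1)
          (rbaseEmb hn (shiftLabels P t Ω)) (rstairContour hn (shiftLabels P t Ω)))).submatrix
        (Prod.map (σY P t Ω) id) (Prod.map (σY P t Ω) id)
      = keff (torWt n P (fineDom n Ω)) m2 a (((n : ℝ) ^ (d + 1))⁻¹) (rBlkWt n Ω (fineDom n Ω))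
        (fieldLink F (e / n) fun u v : ↥(fineDom n Ω) => torBond n P Ac u.1 v.1)
        (contourTrans (fieldLink F (e / n) fun u v : ↥(fineDom n Ω) => torBond n P Ac u.1 v.1) (rbaseEmb hn Ω)
          (rstairContour hn Ω)) := by
  rw [keff_torus_eq, keff_torus_eq, ← green_shift hn P hP t hΩ Ac Ac' hA F e a m2,
    ← avgQ_shift hn P hP t hΩ Ac Ac' hA F (e / n), Matrix.transpose_submatrix, ← σTι_eq P t hn hΩ hP,
    ← σYι_eq P t hΩ hP, Matrix.submatrix_mul_equiv, Matrix.submatrix_mul_equiv]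
  ext p q
  simp only [Matrix.submatrix_apply, Matrix.sub_apply, Matrix.smul_apply, smul_eq_mul]
  congr 2
  rw [← Matrix.submatrix_apply (1 : Matrix _ _ ℝ) (σYι ι P t hΩ hP) (σYι ι P t hΩ hP) p q,
    Matrix.submatrix_one_equiv]

include hP hΩ hA in
/-- **THE FORM OF `Δ^{(k)}_T` IS TRANSLATION INVARIANT**: `⟨ψ∘σY⁻¹, Δ^{(k)}_T(Ω + t, A′)(ψ∘σY⁻¹)⟩ = ⟨ψ, Δ^{(k)}_T(Ω, A)ψ⟩`.
[cite: Balaban1983RegularityDecay, p. 573 (1.14), p. 572 «periodic conditions»] -/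
theorem tform_shift (e a m2 : ℝ) (ψ : ↥Ω × ι → ℝ) :
    (ψ ∘ (σYι ι P t hΩ hP).symm) ⬝ᵥ
        (keff (torWt n P (fineDom n (shiftLabels P t Ω))) m2 a (((n : ℝ) ^ (d + 1))⁻¹)
          (rBlkWt n (shiftLabels P t Ω) (fineDom n (shiftLabels P t Ω)))
          (fieldLink F (e / n) fun u v : ↥(fineDom n (shiftLabels P t Ω)) => torBond n P Ac' u.1 v.1)
          (contourTrans (fieldLink F (e / n) fun u v : ↥(fineDom n (shiftLabels P t Ω)) => torBond n P Ac' u.1 v.1)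
            (rbaseEmb hn (shiftLabels P t Ω)) (rstairContour hn (shiftLabels P t Ω))) *ᵥ
          (ψ ∘ (σYι ι P t hΩ hP).symm))
      = ψ ⬝ᵥ (keff (torWt n P (fineDom n Ω)) m2 a (((n : ℝ) ^ (d + 1))⁻¹) (rBlkWt n Ω (fineDom n Ω))
          (fieldLink F (e / n) fun u v : ↥(fineDom n Ω) => torBond n P Ac u.1 v.1)
          (contourTrans (fieldLink F (e / n) fun u v : ↥(fineDom n Ω) => torBond n P Ac u.1 v.1) (rbaseEmb hn Ω)
            (rstairContour hn Ω)) *ᵥ ψ) := by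
  rw [← keff_torus_shift F hn P hP t hΩ Ac Ac' hA e a m2, ← σYι_eq P t hΩ hP, Matrix.submatrix_mulVec_equiv,
    ← comp_equiv_symm_dotProduct]

omit [DecidableEq ι] in
include hP hΩ in
/-- `|ψ∘σY⁻¹|² = |ψ|²` (relabelling of a finite sum). [cite: Balaban1983RegularityDecay, p. 574 (1.22) «Σ_{x∈Ω^{(k)}}|φ(x)|²», dictionary] -/
theorem l2_shift (ψ : ↥Ω × ι → ℝ) :
    (ψ ∘ (σYι ι P t hΩ hP).symm) ⬝ᵥ (ψ ∘ (σYι ι P t hΩ hP).symm) = ψ ⬝ᵥ ψ :=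
  comp_equiv_dotProduct_comp_equiv ψ ψ (σYι ι P t hΩ hP).symm

end Shift

/-! ## §4. The unit-lattice links `U(A(⟨y, y + e_μ⟩))` of (1.22) through the periodic field and a translation -/

section Links

variable {n : ℕ} (hn : 1 ≤ n) {P : Fin (d + 1) → ℕ} (hP : ∀ ν, 1 ≤ P ν)

omit [Fintype ι] [DecidableEq ι] in
include hn in
/-- the fine points `n·y + i·e_μ`, `i < n`, of the straight contour from the base corner of `B(y)` lie in the fine
period box when `y` is a label of the period box. [cite: Balaban1983RegularityDecay, (1.1) p. 572, dictionary] -/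
theorem base_add_mem_perBox {y : Fin (d + 1) → ℤ} (hy : y ∈ boxDom P) (μ : Fin (d + 1)) {i : ℕ} (hi : i < n) :
    base n y + i • e1 μ ∈ boxDom (per n P) := by
  rw [mem_boxDom] at hy ⊢
  intro k
  rw [add_nsmul_e1_apply]
  obtain ⟨h0, h1⟩ := hy k
  have hn0 : (0 : ℤ) < n := by exact_mod_cast hn
  have hi' : (i : ℤ) < n := by exact_mod_cast hi
  have hi0 : (0 : ℤ) ≤ i := by positivity
  have hPk : ((per n P k : ℕ) : ℤ) = (n : ℤ) * (P k : ℤ) := by simp [per]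
  have hy1 : y k + 1 ≤ (P k : ℤ) := by omega
  simp only [base]
  rw [hPk]
  split_ifs with hk
  · constructor
    · nlinarith
    · nlinarith
  · constructor
    · nlinarith
    · nlinarith

omit [Fintype ι] [DecidableEq ι] in
include hn in
/-- the fine points `n·y + i·e_μ`, `i < n`, lie in the block `B(y)`. [cite: Balaban1983RegularityDecay, (1.1) p. 572 «B^k(y)», dictionary] -/
theorem blk_base_add (y : Fin (d + 1) → ℤ) (μ : Fin (d + 1)) {i : ℕ} (hi : i < n) :
    blk n (base n y + i • e1 μ) = y := by
  funext k
  have hn0 : (n : ℤ) ≠ 0 := by exact_mod_cast (show n ≠ 0 by omega)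
  have hi' : (i : ℤ) < n := by exact_mod_cast hi
  have hi0 : (0 : ℤ) ≤ i := by positivity
  show (base n y + i • e1 μ) k / (n : ℤ) = y k
  rw [add_nsmul_e1_apply]
  simp only [base]
  split_ifs with hk
  · rw [add_comm, Int.add_mul_ediv_left _ _ hn0, Int.ediv_eq_zero_of_lt hi0 hi', zero_add]
  · rw [Int.mul_ediv_cancel_left _ hn0]

include hn in
/-- **THE UNIT-LATTICE LINK OF THE TORUS FIELD IS THAT OF ITS PERIODIC EXTENSION**: for a label `y` of the period box,
`U(A^per(⟨y, y+e_μ⟩)) = U(A(⟨y, y+e_μ⟩))` (the straight contour of `n` steps from `n·y` stays in `B(y)`, inside the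
period box). [cite: Balaban1983RegularityDecay, p. 574 (1.22) «U(A(⟨x,x′⟩))», p. 572 «periodic conditions»] -/
theorem clink_perField (F : OrthFlow ι) (κ : ℝ) (Ac : (Fin (d + 1) → ℤ) → Fin (d + 1) → ℝ)
    {y : Fin (d + 1) → ℤ} (hy : y ∈ boxDom P) (μ : Fin (d + 1)) :
    clink F κ (perField n P Ac) n y μ = clink F κ Ac n y μ := by
  rw [clink_eq, clink_eq, segSum_eq_sum, segSum_eq_sum]
  congr 2
  refine Finset.sum_congr rfl fun i hi => ?_
  rw [perField_of_mem Ac (base_add_mem_perBox hn hy μ (Finset.mem_range.1 hi))]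

include hn hP in
/-- **THE UNIT-LATTICE LINK RELABELS UNDER A TRANSLATION OF THE TORUS**: for the relabelled field `A′(x + nt) = A(x)`
(on the fine period box) and a label `y` of the period box, `U(A′^per(⟨y + t, y + t + e_μ⟩)) = U(A(⟨y, y+e_μ⟩))` (on
the block `B(y)` the torus translation is the lattice translation onto `B(y + t mod P)`, p23's `tfin_eq_add_of_blk`).
[cite: Balaban1983RegularityDecay, p. 574 (1.22) «U(A(⟨x,x′⟩))», p. 572 «periodic conditions»] -/
theorem clink_shift (F : OrthFlow ι) (κ : ℝ) (t : Fin (d + 1) → ℤ) (Ac Ac' : (Fin (d + 1) → ℤ) → Fin (d + 1) → ℝ)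
    (hA : ∀ z ∈ boxDom (per n P), Ac' (tfin P t n z) = Ac z) {y : Fin (d + 1) → ℤ} (hy : y ∈ boxDom P)
    (μ : Fin (d + 1)) :
    clink F κ (perField n P Ac') n (tlab P t y) μ = clink F κ Ac n y μ := by
  rw [clink_eq, clink_eq, segSum_eq_sum, segSum_eq_sum]
  congr 2
  refine Finset.sum_congr rfl fun i hi => ?_
  have hi' : i < n := Finset.mem_range.1 hi
  have hmem' : base n (tlab P t y) + i • e1 μ ∈ boxDom (per n P) :=
    base_add_mem_perBox hn (tlab_mem_boxDom P t hP y) μ hi'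
  rw [perField_of_mem Ac' hmem']
  have hpt : tfin P t n (base n y + i • e1 μ) = base n (tlab P t y) + i • e1 μ := by
    rw [tfin_eq_add_of_blk P t hn hP (blk_base_add hn y μ hi')]
    funext k
    simp only [base, Pi.add_apply, Pi.sub_apply]
    ring
  rw [← hpt, hA _ (base_add_mem_perBox hn hy μ hi')]

end Links

/-! ## §5. Every unit bond of the torus is a lattice bond of one of two period boxes -/

section Cover

variable (P : Fin (d + 1) → ℕ)

omit [Fintype ι] [DecidableEq ι]

/-- translating the reduced end-point: `(y + e_μ mod P) + t mod P = ((y + t mod P) + e_μ) mod P`.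
[cite: Balaban1983RegularityDecay, p. 572 «periodic conditions», dictionary] -/
theorem tlab_wrap_add_e1 (t y : Fin (d + 1) → ℤ) (μ : Fin (d + 1)) :
    tlab P t (wrap P (y + e1 μ)) = wrap P (tlab P t y + e1 μ) := by
  unfold tlab
  rw [wrap_wrap_add, wrap_wrap_add, add_right_comm]

/-- if `(y + t mod P) + e_μ` is a label of the period box, it IS the translate of the end-point `y + e_μ mod P`.
[cite: Balaban1983RegularityDecay, p. 572 «periodic conditions», dictionary] -/
theorem tlab_wrap_add_e1_of_mem (t y : Fin (d + 1) → ℤ) (μ : Fin (d + 1)) (h : tlab P t y + e1 μ ∈ boxDom P) :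
    tlab P t (wrap P (y + e1 μ)) = tlab P t y + e1 μ := by
  rw [tlab_wrap_add_e1, wrap_of_mem P h]

/-- **THE TWO-CHART COVER OF THE TORUS BONDS**: for `P_μ ≥ 2` and a label `y` of the period box, the unit bond
`⟨y, y + e_μ mod P⟩` of the torus does not cross the seam of the period box (`y + e_μ ∈ boxDom P`) or does not cross
the seam of the period box of the torus translated by `𝟙 = (1,…,1)` (`(y + 𝟙 mod P) + e_μ ∈ boxDom P`).
[cite: Balaban1983RegularityDecay, p. 572 «a rectangular parallelepiped in ηZ^d with periodic conditions», dictionary] -/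
theorem bond_cover {μ : Fin (d + 1)} (hP2 : 2 ≤ P μ) (hP : ∀ ν, 1 ≤ P ν) {y : Fin (d + 1) → ℤ}
    (hy : y ∈ boxDom P) :
    y + e1 μ ∈ boxDom P ∨ tlab P (fun _ => 1) y + e1 μ ∈ boxDom P := by
  rw [mem_boxDom] at hy
  by_cases hlt : y μ + 1 < (P μ : ℤ)
  · left
    rw [mem_boxDom]
    intro k
    rw [Pi.add_apply]
    obtain ⟨h0, h1⟩ := hy k
    by_cases hk : k = μ
    · subst hk
      rw [e1_apply_self]
      exact ⟨by linarith, hlt⟩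
    · rw [e1_apply_ne hk, add_zero]
      exact ⟨h0, h1⟩
  · right
    have heq : y μ + 1 = (P μ : ℤ) := by
      have := (hy μ).2
      omega
    rw [mem_boxDom]
    intro k
    rw [Pi.add_apply]
    have hPk : (0 : ℤ) < P k := by exact_mod_cast hP k
    have hw : tlab P (fun _ => 1) y k = (y k + 1) % (P k : ℤ) := rfl
    rw [hw]
    by_cases hk : k = μ
    · subst hk
      rw [e1_apply_self, heq, Int.emod_self]
      constructor
      · norm_num
      · exact_mod_cast hP2
    · rw [e1_apply_ne hk, add_zero]
      exact ⟨Int.emod_nonneg _ hPk.ne', Int.emod_lt_of_pos _ hPk⟩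

end Cover

end

end Literature.MathematicalPhysics.QuantumFieldTheory.Balaban1983to89.B4Prop31TorusTransfer
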